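import Summits.CriticalPhenomena.PercolationContinuityZ3.Theorems.PercNearOneGluingNoHeavyLowerTailStarSetLoadSwap
import Summits.CriticalPhenomena.PercolationContinuityZ3.Theorems.PercNearOneGluingNoHeavyLowerTailStarSetOmegaCliques
import HarnessLib

/-!
# `NoHeavyLowerTail` (stmt-CriticalPhenomena-4575) — the swap family of the unit bound: accounting (U1-PROOF §5; blueprint §C (Φ), §F3, §G3)

Support file (prover `prim-gen-swap` gen 13; `--supports stmt-CriticalPhenomena-4575`).  No definitions, no named facts, no sorries.

The Φ family of the charging scheme, ACCOUNTING ONLY (the structural facts are hypotheses, discharged by the assembly from `swap_mem_cred`,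
`swap_weight_ge`, `swap_fibre_card_le_two`, `swap_targets_one_port`).  Units `u = (S, X)` with `S = Z_u ∪ {X}`, swapped through the port
`prt u ∈ X` into the credit configuration `tgt u = Z_u ∪ {child (prt u)}` of weight `≥ W(S)`; two distinct units with the same target share the
port and come with an r-free triangle `{X, X′, Y}` (`Y ∈ Z`) whose class-set capacity is `≥ 8·min(θ_X, θ_X′)·θ_Y`; no three units share a target.
Then the heavier unit of a 2-fibre is paid by the target and the lighter by the triangle (per triangle and hub pair one overflow stream,
`overflow_stream_le`; three hub pairs per triangle):
`Σ_{u∈U} W(S_u) ≤ Σ_{ω ∈ tgt(U)} W(ω) + (3/8)·Σ_{T ∈ TRIS} C_T`.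

* `StarSet.familySwap_bound`.
-/

namespace Summit.CriticalPhenomena.PercolationContinuityZ3.Theorems

open Finset
open scoped BigOperators Classical

namespace StarSet

variable {ι V : Type*} [Fintype ι] [DecidableEq ι] [DecidableEq V]

/-- **The swap family bound (accounting).**  See the file header for the hypotheses. -/
theorem familySwap_bound (P P' : ι → V)
    (hinj : Function.Injective fun X => (s(P X, P' X) : Sym2 V))
    (θ : ι → ℝ) (hθ0 : ∀ X, 0 ≤ θ X) (hθ1 : ∀ X, θ X ≤ 1)
    (TRIS : Finset (Finset ι)) (C : Finset ι → ℝ) (hC0 : ∀ T, 0 ≤ C T)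
    (U : Finset (Finset ι × ι)) (Z : Finset ι × ι → Finset ι) (prt : Finset ι × ι → V) (child : V → ι)
    (hU : ∀ u ∈ U, u.1 = insert u.2 (Z u) ∧ u.2 ∉ Z u ∧ child (prt u) ∉ Z u ∧ (P u.2 = prt u ∨ P' u.2 = prt u) ∧
      (∏ k ∈ u.1, θ k) * ∏ k ∈ univ \ u.1, (1 - θ k) ≤
        (∏ k ∈ insert (child (prt u)) (Z u), θ k) * ∏ k ∈ univ \ insert (child (prt u)) (Z u), (1 - θ k))
    (hpair : ∀ u ∈ U, ∀ v ∈ U, u ≠ v → insert (child (prt u)) (Z u) = insert (child (prt v)) (Z v) →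
      prt u = prt v ∧ ∃ Y ∈ Z u, ({u.2, v.2, Y} : Finset ι) ∈ TRIS ∧ ({u.2, v.2, Y} : Finset ι).card = 3 ∧
        8 * (min (θ u.2) (θ v.2) * θ Y) ≤ C {u.2, v.2, Y})
    (htwo : ∀ u ∈ U, ∀ v ∈ U, ∀ w ∈ U, insert (child (prt u)) (Z u) = insert (child (prt v)) (Z v) →
      insert (child (prt u)) (Z u) = insert (child (prt w)) (Z w) → u = v ∨ u = w ∨ v = w) :
    ∑ u ∈ U, ((∏ k ∈ u.1, θ k) * ∏ k ∈ univ \ u.1, (1 - θ k)) ≤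
      ∑ ω ∈ U.image (fun u => insert (child (prt u)) (Z u)), ((∏ k ∈ ω, θ k) * ∏ k ∈ univ \ ω, (1 - θ k)) +
        (3 / 8) * ∑ T ∈ TRIS, C T := by
  set W : Finset ι → ℝ := fun S => (∏ k ∈ S, θ k) * ∏ k ∈ univ \ S, (1 - θ k) with hW
  set tgt : Finset ι × ι → Finset ι := fun u => insert (child (prt u)) (Z u) with htgt
  have hW0 : ∀ S, 0 ≤ W S := fun S =>
    mul_nonneg (prod_nonneg fun k _ => hθ0 k) (prod_nonneg fun k _ => sub_nonneg.2 (hθ1 k))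
  -- two-element fibres: choose the two units and the third class once per target
  set two : Finset ι → Prop := fun ω => ∃ u ∈ U, ∃ v ∈ U, u ≠ v ∧ tgt u = ω ∧ tgt v = ω with htwo_def
  have hdata : ∀ ω, two ω → ∃ u ∈ U, ∃ v ∈ U, u ≠ v ∧ tgt u = ω ∧ tgt v = ω := fun ω h => h
  choose fu hfuU fv hfvU hfne hfuω hfvω using hdata
  have hprt : ∀ ω (h : two ω), prt (fu ω h) = prt (fv ω h) := fun ω h =>
    (hpair _ (hfuU ω h) _ (hfvU ω h) (hfne ω h) ((hfuω ω h).trans (hfvω ω h).symm)).1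
  have hYex : ∀ ω (h : two ω), ∃ Y ∈ Z (fu ω h), ({(fu ω h).2, (fv ω h).2, Y} : Finset ι) ∈ TRIS ∧
      ({(fu ω h).2, (fv ω h).2, Y} : Finset ι).card = 3 ∧
      8 * (min (θ (fu ω h).2) (θ (fv ω h).2) * θ Y) ≤ C {(fu ω h).2, (fv ω h).2, Y} := fun ω h =>
    (hpair _ (hfuU ω h) _ (hfvU ω h) (hfne ω h) ((hfuω ω h).trans (hfvω ω h).symm)).2
  choose fY hfYZ hfT hfcard hfcap using hYex
  have hZeq : ∀ ω (h : two ω), Z (fv ω h) = Z (fu ω h) := by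
    intro ω h
    have hA : child (prt (fv ω h)) = child (prt (fu ω h)) := by rw [hprt ω h]
    have he := (hfuω ω h).trans (hfvω ω h).symm
    simp only [htgt] at he
    rw [hA] at he
    have hAu : child (prt (fu ω h)) ∉ Z (fu ω h) := (hU _ (hfuU ω h)).2.2.1
    have hAv : child (prt (fu ω h)) ∉ Z (fv ω h) := by rw [← hA]; exact (hU _ (hfvU ω h)).2.2.1
    rw [← erase_insert hAu, ← erase_insert hAv, he]
  -- overflow term, triangle and hub pair of a target
  set m : Finset ι → ℝ := fun ω => if h : two ω then min (W (fu ω h).1) (W (fv ω h).1) else 0 with hm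
  set Δ : Finset ι → Finset ι := fun ω => if h : two ω then ({(fu ω h).2, (fv ω h).2, fY ω h} : Finset ι) else ∅ with hΔ
  set hp : Finset ι → Finset ι := fun ω => if h : two ω then ({(fu ω h).2, (fv ω h).2} : Finset ι) else ∅ with hhp
  -- Step 1: per target, the fibre is paid by the target plus the overflow term
  have hfibre : ∀ ω ∈ U.image tgt, ∑ u ∈ U.filter (fun u => tgt u = ω), W u.1 ≤ W ω + m ω := by
    intro ω hω
    obtain ⟨u₀, hu₀, hu₀ω⟩ := mem_image.1 hω
    by_cases h2 : two ω
    · have hfib : U.filter (fun w => tgt w = ω) = {fu ω h2, fv ω h2} := by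
        ext w
        simp only [mem_filter, mem_insert, mem_singleton]
        constructor
        · rintro ⟨hwU, hwω⟩
          rcases htwo _ (hfuU ω h2) _ (hfvU ω h2) w hwU ((hfuω ω h2).trans (hfvω ω h2).symm)
            ((hfuω ω h2).trans hwω.symm) with h | h | h
          · exact absurd h (hfne ω h2)
          · exact Or.inl h.symm
          · exact Or.inr h.symm
        · rintro (rfl | rfl)
          · exact ⟨hfuU ω h2, hfuω ω h2⟩
          · exact ⟨hfvU ω h2, hfvω ω h2⟩
      rw [hfib, sum_pair (hfne ω h2)]
      have hmω : m ω = min (W (fu ω h2).1) (W (fv ω h2).1) := by simp only [hm, dif_pos h2]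
      rw [hmω]
      have h1 : W (fu ω h2).1 ≤ W ω := by
        have h := (hU _ (hfuU ω h2)).2.2.2.2
        have e := hfuω ω h2
        simp only [htgt] at e
        rw [e] at h; exact h
      have h2' : W (fv ω h2).1 ≤ W ω := by
        have h := (hU _ (hfvU ω h2)).2.2.2.2
        have e := hfvω ω h2
        simp only [htgt] at e
        rw [e] at h; exact h
      linarith [swap_pair_charge_le (W (fu ω h2).1) (W (fv ω h2).1) (W ω) h1 h2']
    · have hfib : U.filter (fun w => tgt w = ω) = {u₀} := by
        ext w
        simp only [mem_filter, mem_singleton]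
        constructor
        · rintro ⟨hwU, hwω⟩
          by_contra hne
          exact h2 ⟨w, hwU, u₀, hu₀, hne, hwω, hu₀ω⟩
        · rintro rfl; exact ⟨hu₀, hu₀ω⟩
      rw [hfib, sum_singleton]
      have hmω : m ω = 0 := by simp only [hm, dif_neg h2]
      rw [hmω, add_zero, ← hu₀ω]
      exact (hU u₀ hu₀).2.2.2.2
  -- Step 2: the overflow terms are paid by the triangles
  have hover : ∑ ω ∈ U.image tgt, m ω ≤ (3 / 8) * ∑ T ∈ TRIS, C T := by
    have hsplit : ∑ ω ∈ U.image tgt, m ω = ∑ ω ∈ (U.image tgt).filter two, m ω := by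
      rw [sum_filter]
      refine sum_congr rfl fun ω _ => ?_
      by_cases h : two ω
      · rw [if_pos h]
      · rw [if_neg h]; simp only [hm, dif_neg h]
    rw [hsplit]
    have hmaps : ∀ ω ∈ (U.image tgt).filter two, Δ ω ∈ TRIS := fun ω hω => by
      have h2 : two ω := (mem_filter.1 hω).2
      simp only [hΔ, dif_pos h2]; exact hfT ω h2
    rw [← sum_fiberwise_of_maps_to hmaps, mul_sum]
    refine sum_le_sum fun T hT => ?_
    rcases (((U.image tgt).filter two).filter (fun ω => Δ ω = T)).eq_empty_or_nonempty with hemp | ⟨ω₁, hω₁⟩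
    · rw [hemp, sum_empty]; exact mul_nonneg (by norm_num) (hC0 T)
    have h2₁ : two ω₁ := (mem_filter.1 (mem_filter.1 hω₁).1).2
    have hT3 : T.card = 3 := by
      rw [← (mem_filter.1 hω₁).2]; simp only [hΔ, dif_pos h2₁]; exact hfcard ω₁ h2₁
    -- group by hub pair, a 2-subset of `T`
    have hmaps2 : ∀ ω ∈ ((U.image tgt).filter two).filter (fun ω => Δ ω = T), hp ω ∈ T.powersetCard 2 := by
      intro ω hω
      have hω' := mem_filter.1 hω
      have h2 : two ω := (mem_filter.1 hω'.1).2
      have hΔω : Δ ω = {(fu ω h2).2, (fv ω h2).2, fY ω h2} := by simp only [hΔ, dif_pos h2]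
      have hhpω : hp ω = {(fu ω h2).2, (fv ω h2).2} := by simp only [hhp, dif_pos h2]
      have hcard := hfcard ω h2
      rw [mem_powersetCard, hhpω, ← hω'.2, hΔω]
      have hne : (fu ω h2).2 ≠ (fv ω h2).2 := by
        intro h
        rw [h, insert_eq_of_mem (mem_insert_self _ _)] at hcard
        have : ({(fv ω h2).2, fY ω h2} : Finset ι).card ≤ 2 := card_le_two
        omega
      refine ⟨fun K hK => ?_, card_pair hne⟩
      rcases mem_insert.1 hK with rfl | hK
      · exact mem_insert_self _ _
      · rw [mem_singleton.1 hK]; exact mem_insert_of_mem (mem_insert_self _ _)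
    rw [← sum_fiberwise_of_maps_to hmaps2]
    -- each hub-pair class is one overflow stream
    have hstream : ∀ q ∈ T.powersetCard 2,
        ∑ ω ∈ (((U.image tgt).filter two).filter (fun ω => Δ ω = T)).filter (fun ω => hp ω = q), m ω ≤ C T / 8 := by
      intro q hq
      set Cls := (((U.image tgt).filter two).filter (fun ω => Δ ω = T)).filter (fun ω => hp ω = q) with hCls
      rcases Cls.eq_empty_or_nonempty with hemp | ⟨ω₀, hω₀⟩
      · rw [hemp, sum_empty]; exact div_nonneg (hC0 T) (by norm_num)
      have hmemCls : ∀ ω ∈ Cls, two ω ∧ Δ ω = T ∧ hp ω = q := fun ω hω =>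
        ⟨(mem_filter.1 (mem_filter.1 (mem_filter.1 hω).1).1).2, (mem_filter.1 (mem_filter.1 hω).1).2, (mem_filter.1 hω).2⟩
      -- reference data from `ω₀`
      obtain ⟨h2₀, hΔ₀T, hhp₀q⟩ := hmemCls ω₀ hω₀
      have hq₀ : q = {(fu ω₀ h2₀).2, (fv ω₀ h2₀).2} := by rw [← hhp₀q]; simp only [hhp, dif_pos h2₀]
      have hT₀ : T = {(fu ω₀ h2₀).2, (fv ω₀ h2₀).2, fY ω₀ h2₀} := by rw [← hΔ₀T]; simp only [hΔ, dif_pos h2₀]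
      have hcard₀ := hfcard ω₀ h2₀
      have hcap₀ := hfcap ω₀ h2₀
      have hY₀Z := hfYZ ω₀ h2₀
      have hXnot : (fu ω₀ h2₀).2 ∉ Z (fu ω₀ h2₀) := (hU _ (hfuU ω₀ h2₀)).2.1
      have hX'not : (fv ω₀ h2₀).2 ∉ Z (fu ω₀ h2₀) := by rw [← hZeq ω₀ h2₀]; exact (hU _ (hfvU ω₀ h2₀)).2.1
      set X := (fu ω₀ h2₀).2 with hX
      set X' := (fv ω₀ h2₀).2 with hX'
      set Y₀ := fY ω₀ h2₀ with hY₀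
      have hXX' : X ≠ X' := by
        intro h
        rw [h, insert_eq_of_mem (mem_insert_self _ _)] at hcard₀
        have : ({X', Y₀} : Finset ι).card ≤ 2 := card_le_two
        omega
      have hXY₀ : X ≠ Y₀ := by
        intro h; rw [h] at hXnot; exact hXnot hY₀Z
      have hX'Y₀ : X' ≠ Y₀ := by
        intro h; rw [h] at hX'not; exact hX'not hY₀Z
      -- every target of the class: hubs `{X, X'}`, `Y₀ ∈ Z`
      have hcls : ∀ ω ∈ Cls, ∀ h : two ω, ({(fu ω h).2, (fv ω h).2} : Finset ι) = {X, X'} ∧ Y₀ ∈ Z (fu ω h) := by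
        intro ω hω h
        obtain ⟨-, hΔωT, hhpωq⟩ := hmemCls ω hω
        have hhubs : ({(fu ω h).2, (fv ω h).2} : Finset ι) = {X, X'} := by
          rw [← hq₀, ← hhpωq]; simp only [hhp, dif_pos h]
        refine ⟨hhubs, ?_⟩
        have hTω : ({(fu ω h).2, (fv ω h).2, fY ω h} : Finset ι) = {X, X', Y₀} := by
          rw [← hT₀, ← hΔωT]; simp only [hΔ, dif_pos h]
        have hY₀mem : Y₀ ∈ ({(fu ω h).2, (fv ω h).2, fY ω h} : Finset ι) := by rw [hTω]; simp
        have hY₀ne : Y₀ ∉ ({(fu ω h).2, (fv ω h).2} : Finset ι) := by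
          rw [hhubs]; simp [Ne.symm hXY₀, Ne.symm hX'Y₀]
        simp only [mem_insert, mem_singleton, not_or] at hY₀mem hY₀ne
        rcases hY₀mem with h' | h' | h'
        · exact absurd h' hY₀ne.1
        · exact absurd h' hY₀ne.2
        · rw [h']; exact hfYZ ω h
      -- the port of a class member is the common port of `X ≠ X'`
      have hport : ∀ ω ∈ Cls, ∀ h : two ω, (P X = prt (fu ω h) ∨ P' X = prt (fu ω h)) ∧
          (P X' = prt (fu ω h) ∨ P' X' = prt (fu ω h)) := by
        intro ω hω h
        have hh := (hcls ω hω h).1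
        have hpu := (hU _ (hfuU ω h)).2.2.2.1
        have hpv := (hU _ (hfvU ω h)).2.2.2.1
        rw [← hprt ω h] at hpv
        have hu2 : (fu ω h).2 ∈ ({X, X'} : Finset ι) := by rw [← hh]; simp
        have hv2 : (fv ω h).2 ∈ ({X, X'} : Finset ι) := by rw [← hh]; simp
        have hne : (fu ω h).2 ≠ (fv ω h).2 := by
          intro he
          have : ({(fu ω h).2, (fv ω h).2} : Finset ι).card = 1 := by rw [he]; simp
          rw [hh, card_pair hXX'] at this; omega
        simp only [mem_insert, mem_singleton] at hu2 hv2
        rcases hu2 with h1 | h1 <;> rcases hv2 with h2 | h2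
        · exact absurd (h1.trans h2.symm) hne
        · rw [h1] at hpu; rw [h2] at hpv; exact ⟨hpu, hpv⟩
        · rw [h1] at hpu; rw [h2] at hpv; exact ⟨hpv, hpu⟩
        · exact absurd (h1.trans h2.symm) hne
      have huniq : ∀ d₁ d₂ : V, (P X = d₁ ∨ P' X = d₁) → (P X' = d₁ ∨ P' X' = d₁) →
          (P X = d₂ ∨ P' X = d₂) → (P X' = d₂ ∨ P' X' = d₂) → d₁ = d₂ := by
        intro d₁ d₂ h1 h1' h2 h2'
        by_contra hne
        apply hXX'
        apply hinj
        show (s(P X, P' X) : Sym2 V) = s(P X', P' X')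
        rw [sym2_eq_of_mem_of_mem hne h1 h2, sym2_eq_of_mem_of_mem hne h1' h2']
      -- the map `ω ↦ Z` is injective on the class
      set Zof : Finset ι → Finset ι := fun ω => if h : two ω then Z (fu ω h) else ∅ with hZof
      have hZof_eq : ∀ ω (h : two ω), Zof ω = Z (fu ω h) := fun ω h => by simp only [hZof, dif_pos h]
      have hinjZ : Set.InjOn Zof ↑Cls := by
        intro ω₁ hω₁ ω₂ hω₂ he
        have h₁ := (hmemCls ω₁ hω₁).1
        have h₂ := (hmemCls ω₂ hω₂).1
        rw [hZof_eq ω₁ h₁, hZof_eq ω₂ h₂] at he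
        have k1 := hport ω₁ hω₁ h₁
        have k2 := hport ω₂ hω₂ h₂
        have hd : prt (fu ω₁ h₁) = prt (fu ω₂ h₂) := huniq _ _ k1.1 k1.2 k2.1 k2.2
        rw [← hfuω ω₁ h₁, ← hfuω ω₂ h₂]
        show insert (child (prt (fu ω₁ h₁))) (Z (fu ω₁ h₁)) = insert (child (prt (fu ω₂ h₂))) (Z (fu ω₂ h₂))
        rw [he, hd]
      -- rewrite the class sum over the `Z`'s and apply the stream lemma
      have hsum : ∑ ω ∈ Cls, m ω = ∑ Zs ∈ Cls.image Zof, min (W (insert X Zs)) (W (insert X' Zs)) := by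
        rw [sum_image hinjZ]
        refine sum_congr rfl fun ω hω => ?_
        have h := (hmemCls ω hω).1
        have hh := (hcls ω hω h).1
        rw [hZof_eq ω h]
        have hmω : m ω = min (W (fu ω h).1) (W (fv ω h).1) := by simp only [hm, dif_pos h]
        rw [hmω]
        have hu1 : (fu ω h).1 = insert (fu ω h).2 (Z (fu ω h)) := (hU _ (hfuU ω h)).1
        have hv1 : (fv ω h).1 = insert (fv ω h).2 (Z (fu ω h)) := by
          rw [← hZeq ω h]; exact (hU _ (hfvU ω h)).1
        have hu2 : (fu ω h).2 ∈ ({X, X'} : Finset ι) := by rw [← hh]; simp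
        have hv2 : (fv ω h).2 ∈ ({X, X'} : Finset ι) := by rw [← hh]; simp
        have hne : (fu ω h).2 ≠ (fv ω h).2 := by
          intro he
          have : ({(fu ω h).2, (fv ω h).2} : Finset ι).card = 1 := by rw [he]; simp
          rw [hh, card_pair hXX'] at this; omega
        simp only [mem_insert, mem_singleton] at hu2 hv2
        rcases hu2 with h1 | h1 <;> rcases hv2 with h2 | h2
        · exact absurd (h1.trans h2.symm) hne
        · rw [hu1, hv1, h1, h2]
        · rw [hu1, hv1, h1, h2, min_comm]
        · exact absurd (h1.trans h2.symm) hne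
      rw [hsum]
      have hst := overflow_stream_le θ hθ0 hθ1 hXY₀ hX'Y₀ (Cls.image Zof) (fun Zs hZs => by
        obtain ⟨ω, hω, rfl⟩ := mem_image.1 hZs
        have h := (hmemCls ω hω).1
        obtain ⟨hh, hY⟩ := hcls ω hω h
        rw [hZof_eq ω h]
        refine ⟨hY, ?_, ?_⟩
        · have hXmem : X ∈ ({(fu ω h).2, (fv ω h).2} : Finset ι) := by rw [hh]; simp
          simp only [mem_insert, mem_singleton] at hXmem
          rcases hXmem with h' | h'
          · rw [h']; exact (hU _ (hfuU ω h)).2.1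
          · rw [h', ← hZeq ω h]; exact (hU _ (hfvU ω h)).2.1
        · have hXmem : X' ∈ ({(fu ω h).2, (fv ω h).2} : Finset ι) := by rw [hh]; simp
          simp only [mem_insert, mem_singleton] at hXmem
          rcases hXmem with h' | h'
          · rw [h']; exact (hU _ (hfuU ω h)).2.1
          · rw [h', ← hZeq ω h]; exact (hU _ (hfvU ω h)).2.1)
      refine hst.trans ?_
      rw [← min_mul_of_nonneg _ _ (hθ0 Y₀), le_div_iff₀ (by norm_num : (0:ℝ) < 8), hT₀]
      linarith
    calc ∑ q ∈ T.powersetCard 2, ∑ ω ∈ (((U.image tgt).filter two).filter (fun ω => Δ ω = T)).filter (fun ω => hp ω = q), m ω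
        ≤ ∑ q ∈ T.powersetCard 2, C T / 8 := sum_le_sum hstream
      _ = (T.powersetCard 2).card * (C T / 8) := by rw [sum_const, nsmul_eq_mul]
      _ = 3 * (C T / 8) := by rw [card_powersetCard, hT3]; norm_num
      _ = 3 / 8 * C T := by ring
  -- Step 3: assemble
  calc ∑ u ∈ U, W u.1 = ∑ ω ∈ U.image tgt, ∑ u ∈ U.filter (fun u => tgt u = ω), W u.1 :=
        (sum_fiberwise_of_maps_to (fun u hu => mem_image_of_mem tgt hu) _).symm
    _ ≤ ∑ ω ∈ U.image tgt, (W ω + m ω) := sum_le_sum hfibre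
    _ = ∑ ω ∈ U.image tgt, W ω + ∑ ω ∈ U.image tgt, m ω := sum_add_distrib
    _ ≤ _ := add_le_add le_rfl hover

end StarSet

end Summit.CriticalPhenomena.PercolationContinuityZ3.Theorems
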